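import Literature.Computability.Complexity.TM2Iterate
import Literature.Computability.Complexity.StackArith
import Mathlib.Data.Nat.Log
import Mathlib.Data.Nat.Size
import HarnessLib

/-!
# Pass-through computation: running a polynomial-time machine in front of an untouched suffix

Trunk `CplxCore`, toolkit for `TimeBounds.lean` (sibling of `TM2Iterate.lean`, clocked
iteration, and `TM2Context.lean`, computing on the first field while *copying* the context).
Main results:

* `Literature.CplxCore.TM2Pass.passTM M eIn eOut` — for a bundled `M : Turing.FinTM2` over the
  alphabet `Bool` (identifications `eIn`, `eOut` of its input/output alphabets with `Bool`), a
  machine whose input stack *is* its output stack and which, on the input word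
  `passHdr |s| ++ s ++ σ` (a self-delimiting binary header announcing `|s|`, then `s`, then an
  arbitrary suffix `σ`), pops the header and exactly `|s|` further symbols, runs `M` on `s`,
  and pushes `M`'s output back on top of `σ` — the suffix is never read, so the running time
  does not depend on it (`TM2Pass.passAux_outputsWithin`);
* `Literature.Computability.Complexity.TM2Pass.exists_passThrough` — hence: for every polynomial-time
  `F : {0,1}* → {0,1}*` there are a TM2 machine and a polynomial `T` with
  `OutputsWithin (passHdr |s| ++ s ++ σ) (F s ++ σ) (T |s|)` for all `s`, `σ`, where
  `|passHdr n| ≤ 2 ⌊log₂ n⌋ + 4`.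

This is the stack-machine form of "compute `F` on a delimited prefix of the tape and leave the
rest in place", the device behind padding arguments in which a generator `G(s ‖ σ) = F(s) ‖ σ`
must run in time independent of the padding (Liu–Pass 2020, proofs of Thms 5.5–5.6, where it
yields `K^t(F(s) ‖ σ) ≤ |s| + |σ| + O(log |s|)` at every budget `t ≥ T(|s|)`); it discharges
the named fact `Literature.Computability.Cryptography.passThrough_polyTime` (`LiuPassPaddingProofs.lean`).
Contrast `PolyTimeComputable.firstField` (`TM2Context.lean`), whose machine copies the context
from the input stack to a distinct output stack and therefore needs time linear in the context:
Mathlib's halting convention `Turing.haltList` (all stacks but the output stack empty) forces a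
suffix-independent running time to use one stack for input and output, as Mathlib's
`Turing.idComputer` does. Nothing of this is in Mathlib.

## The pass-through machine (`TM2Pass.passTM`)

Stacks `M.K ⊕ Aux` with four auxiliary stacks: `MAIN` (input = output stack, alphabet `Bool`),
`TMP` (`Bool`), the binary counter `CNT` (`Bool`, least significant bit on top) and the marker
stack `MRK` (`Unit`); labels `M.Λ ⊕ Ctrl` with eleven control labels; states
`M.σ × Option Bool` (a register for one popped symbol, reset between steps). Control flow
(`TM2Pass.ctrlStmt`):

* `rd1`, `rd2t`, `rd2f`: read the header two symbols at a time; a pair `bb` is the next binary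
  digit `b` of `|s|` (most significant first) and is pushed on `CNT`; the pair `01` ends the
  header.
* `dec`, `rf`, `cln`, `mv`: count down. `dec` pops the low-order `0`s of `CNT` (one marker on
  `MRK` each) up to the lowest `1`, which becomes `0`; `rf` refills the popped positions with
  `1`s (binary decrement, the length of `CNT` is invariant) and `mv` moves one symbol from
  `MAIN` to `TMP`. If `dec` finds no `1` the counter was zero: `cln` discards the markers and
  jumps to `ld`. After the countdown `TMP` holds `s` reversed and `MAIN` holds `σ`.
* `ld`: pour `TMP` onto the input stack `k₀` of `M` (restoring the order) and jump to `M.main`.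
  The statements of `M` act on the `inl` stacks and the first state component
  (`TM2Pass.trStmt`), `halt` becoming `goto out1`; `M` halts in `haltList` form (output on
  `k₁`, its other stacks empty, state reset).
* `out1`: pour `k₁` onto `TMP`; `out2`: pour `TMP` onto `MAIN` (on top of `σ`, order
  restored); `fin`: reset the state and `halt` — Mathlib's `haltList` convention, all stacks
  but `MAIN` being empty again.

Total time `≤ 2n² + 12n + 12 + (2D + 1) p(n)` for `|s| = n`, `M` running in time `p(n)` with
push bound `D` (`TM2Pass.passPoly`).

## Proof architecture

As in `TM2Iterate.lean`: configurations in the normal form `cfg l v S mn t c mk`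
(`TM2Pass.mkStk` with its `Function.update` lemmas), one-step lemmas for the control labels by
`simp` from the unbundled step equations, phase lemmas by induction (header, one decrement,
the countdown by induction on the counter value, the pours), transport of runs of `M`
(`run_cfgM` via `TM2Comp.iterate_bind_map`), and the final assembly with the polynomial bound.
The binary representation used by the header is Mathlib's little-endian `Computability.encodeNat`
(value `Literature.Computability.Complexity.bitsToNat`, `bitsToNat_encodeNat`, `BoolEncodings.lean`; length
`n.size ≤ ⌊log₂ n⌋ + 1` via `length_norm` / `norm_encodeNat` of `StackArith.lean`).

## References

* S. Arora, B. Barak, *Computational Complexity: A Modern Approach*, CUP 2009, §1.3 (machine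
  constructions on multi-tape machines; counters), Claim 1.6. doi:10.1017/cbo9780511804090
* Y. Liu, R. Pass, *On one-way functions and Kolmogorov complexity*, FOCS 2020, proofs of
  Thms 5.5–5.6 (padding a generator with untouched extra bits). arXiv:2009.11514
* Mathlib, `Mathlib/Computability/TuringMachine/Computable.lean` (`FinTM2`, `initList`,
  `haltList`, `idComputer` with `k₀ = k₁`).
-/

namespace Literature.Computability.Complexity

namespace TM2Pass

open Turing StateTransition Function TM2Comp TM2Iter _root_.Computability

/-! ### Little-endian binary representation: `encodeNat` -/

/-- `|encodeNat n| = n.size` (the number of binary digits; via the normal form of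
`StackArith.lean`). [folklore] -/
theorem length_encodeNat_eq_size (n : ℕ) : (encodeNat n).length = n.size := by
  rw [← norm_encodeNat, length_norm, bitsToNat_encodeNat]

/-- `encodeNat n` has at most `⌊log₂ n⌋ + 1` digits. [folklore] -/
theorem length_encodeNat_le (n : ℕ) : (encodeNat n).length ≤ Nat.log 2 n + 1 := by
  rw [length_encodeNat_eq_size]
  exact Nat.size_le.2 (Nat.lt_pow_succ_log_self one_lt_two n)

/-- `encodeNat n` has at most `n + 1` digits (crude bound used in the time polynomial).
[folklore] -/
theorem length_encodeNat_le_self (n : ℕ) : (encodeNat n).length ≤ n + 1 :=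
  (length_encodeNat_le n).trans (Nat.succ_le_succ ((Nat.log_le_self 2 n)))

/-- The self-delimiting header announcing the length `n`: the binary digits of `n`
(`encodeNat n`), **most significant first** (so that the machine, pushing them as read, ends with
the least significant digit on top of its counter stack), each doubled, followed by the
separator `01` — i.e. `boolPair (encodeNat n).reverse []`, the digit-reversed form of the tree's
`Literature.Lattice.encodeNatSD n = boolPair (encodeNat n) []` (`EuclideanLattices/Encoding.lean`).
[Arora–Barak 2009, §0.1 (pairing)] [cite: AroraBarakCC2009, §0.1] -/
def passHdr (n : ℕ) : List Bool :=
  ((encodeNat n).reverse.flatMap fun b => [b, b]) ++ [false, true]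

/-- The header is the pair `⟨(encodeNat n).reverse, []⟩`. [folklore] -/
theorem passHdr_eq_boolPair (n : ℕ) : passHdr n = boolPair (encodeNat n).reverse [] := by
  simp [passHdr, boolPair]

/-- Length of the header: twice the number of binary digits plus two. [folklore] -/
theorem length_passHdr (n : ℕ) : (passHdr n).length = 2 * (encodeNat n).length + 2 := by
  simp [passHdr, List.length_flatMap, List.sum_replicate, mul_comm]

/-- `|passHdr n| ≤ 2 ⌊log₂ n⌋ + 4`. [folklore] -/
theorem length_passHdr_le (n : ℕ) : (passHdr n).length ≤ 2 * Nat.log 2 n + 4 := by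
  rw [length_passHdr]; have := length_encodeNat_le n; omega

/-! ### The pass-through machine: auxiliary stacks, control labels, alphabets -/

/-- The four auxiliary stacks: `MAIN` (input and output stack, `Bool`), the transfer stack
`TMP` (`Bool`), the binary counter `CNT` (`Bool`) and the marker stack `MRK` (`Unit`).
[folklore] -/
inductive Aux
  | MAIN
  | TMP
  | CNT
  | MRK
  deriving DecidableEq, Fintype

/-- The control labels of the pass-through machine (besides the labels of `M`). [folklore] -/
inductive Ctrl
  | rd1
  | rd2t
  | rd2f
  | dec
  | rf
  | mv
  | cln
  | ld
  | out1
  | out2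
  | fin
  deriving DecidableEq, Fintype

section Machine

variable {K : Type} {G : K → Type} {Λ σ : Type}

/-- Stack alphabets: those of `M` on `inl`, and `Bool`, `Bool`, `Bool`, `Unit` on `MAIN`, `TMP`,
`CNT`, `MRK`. Written with `casesOn` so that it unfolds by `rfl` on constructors. [folklore] -/
abbrev PassΓ (G : K → Type) : K ⊕ Aux → Type := fun j =>
  Sum.casesOn (motive := fun _ => Type) j G
    (fun a => Aux.casesOn (motive := fun _ => Type) a Bool Bool Bool Unit)

/-- Internal states: a state of `M` and a register for one popped bit. [folklore] -/
abbrev St (σ : Type) : Type := σ × Option Bool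

/-- Reset the register. [folklore] -/
def rst : St σ → St σ := fun v => (v.1, none)

/-- Read the register (junk `false` if empty). [folklore] -/
def bget : Option Bool → Bool
  | some b => b
  | none => false

/-- Stack contents from the stacks `S` of `M` and the contents of `MAIN`, `TMP`, `CNT`, `MRK`.
[folklore] -/
def mkStk (S : ∀ k, List (G k)) (mn t c : List Bool) (mk : List Unit) :
    ∀ j : K ⊕ Aux, List (PassΓ G j)
  | Sum.inl k => S k
  | Sum.inr Aux.MAIN => mn
  | Sum.inr Aux.TMP => t
  | Sum.inr Aux.CNT => c
  | Sum.inr Aux.MRK => mk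

section StkLemmas

variable (S : ∀ k, List (G k)) (mn t c : List Bool) (mk : List Unit)

/-- Reading a stack of `M`. [folklore] -/
@[simp] theorem mkStk_inl (k : K) : mkStk S mn t c mk (Sum.inl k) = S k := rfl
/-- Reading `MAIN`. [folklore] -/
@[simp] theorem mkStk_MAIN : mkStk S mn t c mk (Sum.inr Aux.MAIN) = mn := rfl
/-- Reading `TMP`. [folklore] -/
@[simp] theorem mkStk_TMP : mkStk S mn t c mk (Sum.inr Aux.TMP) = t := rfl
/-- Reading `CNT`. [folklore] -/
@[simp] theorem mkStk_CNT : mkStk S mn t c mk (Sum.inr Aux.CNT) = c := rfl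
/-- Reading `MRK`. [folklore] -/
@[simp] theorem mkStk_MRK : mkStk S mn t c mk (Sum.inr Aux.MRK) = mk := rfl

variable {dKA : DecidableEq (K ⊕ Aux)}

/-- Writing a stack of `M` (any decidability instance on `K ⊕ Aux`, so that the lemma also
fires on the instance bundled in a `FinTM2`). [folklore] -/
@[simp] theorem mkStk_update_inl [DecidableEq K] (k : K) (L : List (G k)) :
    @update _ _ dKA (mkStk S mn t c mk) (Sum.inl k) L = mkStk (update S k L) mn t c mk := by
  funext j
  rcases j with k' | a
  · rcases eq_or_ne k' k with rfl | h
    · simp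
    · rw [update_of_ne (by simpa using h)]; simp [update_of_ne h]
  · rw [update_of_ne (by simp)]; cases a <;> rfl

/-- Writing `MAIN`. [folklore] -/
@[simp] theorem mkStk_update_MAIN (mn' : List Bool) :
    @update _ _ dKA (mkStk S mn t c mk) (Sum.inr Aux.MAIN) mn' = mkStk S mn' t c mk := by
  funext j
  rcases j with k' | a
  · rw [update_of_ne (by simp)]; rfl
  · cases a
    · simp
    all_goals rw [update_of_ne (by simp)]; rfl

/-- Writing `TMP`. [folklore] -/
@[simp] theorem mkStk_update_TMP (t' : List Bool) :
    @update _ _ dKA (mkStk S mn t c mk) (Sum.inr Aux.TMP) t' = mkStk S mn t' c mk := by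
  funext j
  rcases j with k' | a
  · rw [update_of_ne (by simp)]; rfl
  · cases a
    case TMP => simp
    all_goals rw [update_of_ne (by simp)]; rfl

/-- Writing `CNT`. [folklore] -/
@[simp] theorem mkStk_update_CNT (c' : List Bool) :
    @update _ _ dKA (mkStk S mn t c mk) (Sum.inr Aux.CNT) c' = mkStk S mn t c' mk := by
  funext j
  rcases j with k' | a
  · rw [update_of_ne (by simp)]; rfl
  · cases a
    case CNT => simp
    all_goals rw [update_of_ne (by simp)]; rfl

/-- Writing `MRK`. [folklore] -/
@[simp] theorem mkStk_update_MRK (mk' : List Unit) :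
    @update _ _ dKA (mkStk S mn t c mk) (Sum.inr Aux.MRK) mk' = mkStk S mn t c mk' := by
  funext j
  rcases j with k' | a
  · rw [update_of_ne (by simp)]; rfl
  · cases a
    case MRK => simp
    all_goals rw [update_of_ne (by simp)]; rfl

/-- The empty stack assignment. [folklore] -/
theorem mkStk_bot :
    mkStk (fun k => ([] : List (G k))) [] [] [] [] = fun j => ([] : List (PassΓ G j)) := by
  funext j
  rcases j with k | a
  · rfl
  · cases a <;> rfl

/-- A single-stack assignment at `MAIN`, embedded. [folklore] -/
theorem mkStk_bot_MAIN [DecidableEq K] (l : List Bool) :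
    mkStk (fun k => ([] : List (G k))) l [] [] [] = update (fun j => ([] : List (PassΓ G j)))
      (Sum.inr Aux.MAIN) l := by
  rw [← mkStk_bot, mkStk_update_MAIN]

end StkLemmas

/-- Translation of the statements of `M`: act on the `inl` stacks and the first state
component; `halt` becomes a jump to the control label `out1`. [folklore] -/
def trStmt : TM2.Stmt G Λ σ → TM2.Stmt (PassΓ G) (Λ ⊕ Ctrl) (St σ)
  | TM2.Stmt.push k f q => TM2.Stmt.push (Sum.inl k) (fun s => f s.1) (trStmt q)
  | TM2.Stmt.peek k f q => TM2.Stmt.peek (Sum.inl k) (fun s x => (f s.1 x, s.2)) (trStmt q)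
  | TM2.Stmt.pop k f q => TM2.Stmt.pop (Sum.inl k) (fun s x => (f s.1 x, s.2)) (trStmt q)
  | TM2.Stmt.load f q => TM2.Stmt.load (fun s => (f s.1, s.2)) (trStmt q)
  | TM2.Stmt.branch p q₁ q₂ => TM2.Stmt.branch (fun s => p s.1) (trStmt q₁) (trStmt q₂)
  | TM2.Stmt.goto l => TM2.Stmt.goto fun s => Sum.inl (l s.1)
  | TM2.Stmt.halt => TM2.Stmt.goto fun _ => Sum.inr Ctrl.out1

/-- Configuration of the pass-through machine while `M` runs (auxiliary stacks empty except
`MAIN`, which holds the untouched suffix `mn`; the halting label is sent to `out1`).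
[folklore] -/
def cfgM (c : TM2.Cfg G Λ σ) (mn : List Bool) : TM2.Cfg (PassΓ G) (Λ ⊕ Ctrl) (St σ) :=
  ⟨some (c.l.elim (Sum.inr Ctrl.out1) Sum.inl), (c.var, none), mkStk c.stk mn [] [] []⟩

/-- One statement of `M` is simulated exactly by its translation. [folklore] -/
theorem stepAux_trStmt [DecidableEq K] (q : TM2.Stmt G Λ σ) (v : σ) (S : ∀ k, List (G k))
    (mn : List Bool) :
    TM2.stepAux (trStmt q) (v, none) (mkStk S mn [] [] []) = cfgM (TM2.stepAux q v S) mn := by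
  induction q generalizing v S with
  | push k f q ih =>
    simp only [trStmt, TM2.stepAux]
    rw [← ih, mkStk_inl, mkStk_update_inl]
  | peek k f q ih => simp only [trStmt, TM2.stepAux]; exact ih _ _
  | pop k f q ih =>
    simp only [trStmt, TM2.stepAux]
    rw [← ih, mkStk_inl, mkStk_update_inl]
  | load f q ih => simp only [trStmt, TM2.stepAux]; exact ih _ _
  | branch p q₁ q₂ ih₁ ih₂ =>
    simp only [trStmt, TM2.stepAux]
    cases p v
    · exact ih₂ _ _
    · exact ih₁ _ _
  | goto l => rfl
  | halt => rfl

variable (k₀ k₁ : K) (eIn : G k₀ ≃ Bool) (eOut : G k₁ ≃ Bool) (main : Λ) (init : σ)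

/-- Jump to a control label after resetting the register. [folklore] -/
abbrev jmp (c : Ctrl) : TM2.Stmt (PassΓ G) (Λ ⊕ Ctrl) (St σ) :=
  TM2.Stmt.load rst <| TM2.Stmt.goto fun _ => Sum.inr c

/-- The control statements of the pass-through machine (see the module docstring).
Every control statement resets the register before jumping. [folklore] -/
def ctrlStmt : Ctrl → TM2.Stmt (PassΓ G) (Λ ⊕ Ctrl) (St σ)
  | Ctrl.rd1 =>
      TM2.Stmt.pop (Sum.inr Aux.MAIN) (fun v a => (v.1, a)) <|
        TM2.Stmt.branch (fun v => v.2.isNone) (jmp Ctrl.fin) <|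
          TM2.Stmt.branch (fun v => bget v.2) (jmp Ctrl.rd2t) (jmp Ctrl.rd2f)
  | Ctrl.rd2t =>
      TM2.Stmt.pop (Sum.inr Aux.MAIN) (fun v a => (v.1, a)) <|
        TM2.Stmt.branch (fun v => v.2.isNone) (jmp Ctrl.fin) <|
          TM2.Stmt.branch (fun v => bget v.2)
            (TM2.Stmt.push (Sum.inr Aux.CNT) (fun _ => true) <| jmp Ctrl.rd1)
            (jmp Ctrl.fin)
  | Ctrl.rd2f =>
      TM2.Stmt.pop (Sum.inr Aux.MAIN) (fun v a => (v.1, a)) <|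
        TM2.Stmt.branch (fun v => v.2.isNone) (jmp Ctrl.fin) <|
          TM2.Stmt.branch (fun v => bget v.2) (jmp Ctrl.dec)
            (TM2.Stmt.push (Sum.inr Aux.CNT) (fun _ => false) <| jmp Ctrl.rd1)
  | Ctrl.dec =>
      TM2.Stmt.pop (Sum.inr Aux.CNT) (fun v a => (v.1, a)) <|
        TM2.Stmt.branch (fun v => v.2.isNone) (jmp Ctrl.cln) <|
          TM2.Stmt.branch (fun v => bget v.2)
            (TM2.Stmt.push (Sum.inr Aux.CNT) (fun _ => false) <| jmp Ctrl.rf)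
            (TM2.Stmt.push (Sum.inr Aux.MRK) (fun _ => ()) <| jmp Ctrl.dec)
  | Ctrl.rf =>
      TM2.Stmt.pop (Sum.inr Aux.MRK) (fun v a => (v.1, a.map fun _ => true)) <|
        TM2.Stmt.branch (fun v => v.2.isNone) (jmp Ctrl.mv)
          (TM2.Stmt.push (Sum.inr Aux.CNT) (fun _ => true) <| jmp Ctrl.rf)
  | Ctrl.mv =>
      TM2.Stmt.pop (Sum.inr Aux.MAIN) (fun v a => (v.1, a)) <|
        TM2.Stmt.branch (fun v => v.2.isNone) (jmp Ctrl.fin)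
          (TM2.Stmt.push (Sum.inr Aux.TMP) (fun v => bget v.2) <| jmp Ctrl.dec)
  | Ctrl.cln =>
      TM2.Stmt.pop (Sum.inr Aux.MRK) (fun v a => (v.1, a.map fun _ => true)) <|
        TM2.Stmt.branch (fun v => v.2.isNone) (jmp Ctrl.ld) (jmp Ctrl.cln)
  | Ctrl.ld =>
      TM2.Stmt.pop (Sum.inr Aux.TMP) (fun v a => (v.1, a)) <|
        TM2.Stmt.branch (fun v => v.2.isNone)
          (TM2.Stmt.load rst <| TM2.Stmt.goto fun _ => Sum.inl main)
          (TM2.Stmt.push (Sum.inl k₀) (fun v => eIn.symm (bget v.2)) <| jmp Ctrl.ld)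
  | Ctrl.out1 =>
      TM2.Stmt.pop (Sum.inl k₁) (fun v a => (v.1, a.map eOut)) <|
        TM2.Stmt.branch (fun v => v.2.isNone) (jmp Ctrl.out2)
          (TM2.Stmt.push (Sum.inr Aux.TMP) (fun v => bget v.2) <| jmp Ctrl.out1)
  | Ctrl.out2 =>
      TM2.Stmt.pop (Sum.inr Aux.TMP) (fun v a => (v.1, a)) <|
        TM2.Stmt.branch (fun v => v.2.isNone) (jmp Ctrl.fin)
          (TM2.Stmt.push (Sum.inr Aux.MAIN) (fun v => bget v.2) <| jmp Ctrl.out2)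
  | Ctrl.fin => TM2.Stmt.load (fun _ => (init, none)) TM2.Stmt.halt

end Machine

/-! ### Bundling: the pass-through machine as a `FinTM2` -/

section Bundled

variable (M : FinTM2)

/-- Configurations with a reset register, from the label, the `M`-state, the stacks of `M`
and the four auxiliary stacks. [folklore] -/
def cfg (l : Option (M.Λ ⊕ Ctrl)) (v : M.σ) (S : ∀ k, List (M.Γ k)) (mn t c : List Bool)
    (mk : List Unit) : TM2.Cfg (PassΓ M.Γ) (M.Λ ⊕ Ctrl) (St M.σ) :=
  ⟨l, (v, none), mkStk S mn t c mk⟩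

/-- The (unbundled) type of configurations of the pass-through machine. [folklore] -/
abbrev LCfg : Type := TM2.Cfg (PassΓ M.Γ) (M.Λ ⊕ Ctrl) (St M.σ)

variable (eIn : M.Γ M.k₀ ≃ Bool) (eOut : M.Γ M.k₁ ≃ Bool)

/-- The pass-through machine of a bundled TM2 machine `M` over `Bool`: stacks `M.K ⊕ Aux`
with input stack = output stack = `inr MAIN`, labels `M.Λ ⊕ Ctrl` (main label `rd1`), states
`M.σ × Option Bool`. On input `passHdr |s| ++ s ++ σ` it outputs `M(s) ++ σ` in time
independent of `σ`. [Arora–Barak 2009, §1.3; Liu–Pass 2020, proofs of Thms 5.5–5.6]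
[cite: AroraBarakCC2009, §1.3] -/
noncomputable def passTM : FinTM2 :=
  letI := M.kFin; letI := M.ΛFin; letI := M.σFin
  { K := M.K ⊕ Aux
    k₀ := Sum.inr Aux.MAIN
    k₁ := Sum.inr Aux.MAIN
    Γ := PassΓ M.Γ
    Λ := M.Λ ⊕ Ctrl
    main := Sum.inr Ctrl.rd1
    σ := St M.σ
    initialState := (M.initialState, none)
    Γk₀Fin := (inferInstance : Fintype Bool)
    m := fun l => match l with
      | Sum.inl l => trStmt (M.m l)
      | Sum.inr c => ctrlStmt M.k₀ M.k₁ eIn eOut M.main M.initialState c }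

/-- A step at a control label, unbundled. [folklore] -/
theorem step_inr (c : Ctrl) (var : St M.σ) (stk : ∀ j, List (PassΓ M.Γ j)) :
    (passTM M eIn eOut).step
        (⟨some (Sum.inr c), var, stk⟩ : TM2.Cfg (PassΓ M.Γ) (M.Λ ⊕ Ctrl) (St M.σ)) =
      some (TM2.stepAux (ctrlStmt M.k₀ M.k₁ eIn eOut M.main M.initialState c) var stk) :=
  rfl

/-- A step at a label of `M`, unbundled. [folklore] -/
theorem step_inl (l : M.Λ) (var : St M.σ) (stk : ∀ j, List (PassΓ M.Γ j)) :
    (passTM M eIn eOut).step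
        (⟨some (Sum.inl l), var, stk⟩ : TM2.Cfg (PassΓ M.Γ) (M.Λ ⊕ Ctrl) (St M.σ)) =
      some (TM2.stepAux (trStmt (M.m l)) var stk) :=
  rfl

/-! ### Single steps of the control labels -/

section Steps

variable (v : M.σ) (S : ∀ k, List (M.Γ k)) (mn t c : List Bool) (mk : List Unit)

/-- `rd1` on a first bit `true`. [folklore] -/
theorem step_rd1_true :
    (passTM M eIn eOut).step (cfg M (some (Sum.inr Ctrl.rd1)) v S (true :: mn) t c mk) =
      some (cfg M (some (Sum.inr Ctrl.rd2t)) v S mn t c mk) := by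
  rw [cfg, step_inr]; simp [ctrlStmt, rst, bget, cfg]

/-- `rd1` on a first bit `false`. [folklore] -/
theorem step_rd1_false :
    (passTM M eIn eOut).step (cfg M (some (Sum.inr Ctrl.rd1)) v S (false :: mn) t c mk) =
      some (cfg M (some (Sum.inr Ctrl.rd2f)) v S mn t c mk) := by
  rw [cfg, step_inr]; simp [ctrlStmt, rst, bget, cfg]

/-- `rd2t` on a second bit `true`: digit `1`. [folklore] -/
theorem step_rd2t_true :
    (passTM M eIn eOut).step (cfg M (some (Sum.inr Ctrl.rd2t)) v S (true :: mn) t c mk) =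
      some (cfg M (some (Sum.inr Ctrl.rd1)) v S mn t (true :: c) mk) := by
  rw [cfg, step_inr]; simp [ctrlStmt, rst, bget, cfg]

/-- `rd2f` on a second bit `false`: digit `0`. [folklore] -/
theorem step_rd2f_false :
    (passTM M eIn eOut).step (cfg M (some (Sum.inr Ctrl.rd2f)) v S (false :: mn) t c mk) =
      some (cfg M (some (Sum.inr Ctrl.rd1)) v S mn t (false :: c) mk) := by
  rw [cfg, step_inr]; simp [ctrlStmt, rst, bget, cfg]

/-- `rd2f` on a second bit `true`: the separator `01`, start the countdown. [folklore] -/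
theorem step_rd2f_true :
    (passTM M eIn eOut).step (cfg M (some (Sum.inr Ctrl.rd2f)) v S (true :: mn) t c mk) =
      some (cfg M (some (Sum.inr Ctrl.dec)) v S mn t c mk) := by
  rw [cfg, step_inr]; simp [ctrlStmt, rst, bget, cfg]

/-- `dec` on a low-order `0`: pop it and leave a marker. [folklore] -/
theorem step_dec_false :
    (passTM M eIn eOut).step (cfg M (some (Sum.inr Ctrl.dec)) v S mn t (false :: c) mk) =
      some (cfg M (some (Sum.inr Ctrl.dec)) v S mn t c (() :: mk)) := by
  rw [cfg, step_inr]; simp [ctrlStmt, rst, bget, cfg]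

/-- `dec` on the lowest `1`: it becomes `0`, proceed to the refill. [folklore] -/
theorem step_dec_true :
    (passTM M eIn eOut).step (cfg M (some (Sum.inr Ctrl.dec)) v S mn t (true :: c) mk) =
      some (cfg M (some (Sum.inr Ctrl.rf)) v S mn t (false :: c) mk) := by
  rw [cfg, step_inr]; simp [ctrlStmt, rst, bget, cfg]

/-- `dec` on an exhausted counter: the count was zero, proceed to the clean-up. [folklore] -/
theorem step_dec_nil :
    (passTM M eIn eOut).step (cfg M (some (Sum.inr Ctrl.dec)) v S mn t [] mk) =
      some (cfg M (some (Sum.inr Ctrl.cln)) v S mn t [] mk) := by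
  rw [cfg, step_inr]; simp [ctrlStmt, rst, cfg]

/-- `rf` on a marker: refill one `1`. [folklore] -/
theorem step_rf_cons (u : Unit) :
    (passTM M eIn eOut).step (cfg M (some (Sum.inr Ctrl.rf)) v S mn t c (u :: mk)) =
      some (cfg M (some (Sum.inr Ctrl.rf)) v S mn t (true :: c) mk) := by
  rw [cfg, step_inr]; simp [ctrlStmt, rst, cfg]

/-- `rf` with no marker left: proceed to `mv`. [folklore] -/
theorem step_rf_nil :
    (passTM M eIn eOut).step (cfg M (some (Sum.inr Ctrl.rf)) v S mn t c []) =
      some (cfg M (some (Sum.inr Ctrl.mv)) v S mn t c []) := by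
  rw [cfg, step_inr]; simp [ctrlStmt, rst, cfg]

/-- `mv`: move one symbol from `MAIN` to `TMP` and return to `dec`. [folklore] -/
theorem step_mv_cons (b : Bool) :
    (passTM M eIn eOut).step (cfg M (some (Sum.inr Ctrl.mv)) v S (b :: mn) t c mk) =
      some (cfg M (some (Sum.inr Ctrl.dec)) v S mn (b :: t) c mk) := by
  rw [cfg, step_inr]; cases b <;> simp [ctrlStmt, rst, bget, cfg]

/-- `cln` on a marker: discard it. [folklore] -/
theorem step_cln_cons (u : Unit) :
    (passTM M eIn eOut).step (cfg M (some (Sum.inr Ctrl.cln)) v S mn t c (u :: mk)) =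
      some (cfg M (some (Sum.inr Ctrl.cln)) v S mn t c mk) := by
  rw [cfg, step_inr]; simp [ctrlStmt, rst, cfg]

/-- `cln` with no marker left: proceed to `ld`. [folklore] -/
theorem step_cln_nil :
    (passTM M eIn eOut).step (cfg M (some (Sum.inr Ctrl.cln)) v S mn t c []) =
      some (cfg M (some (Sum.inr Ctrl.ld)) v S mn t c []) := by
  rw [cfg, step_inr]; simp [ctrlStmt, rst, cfg]

/-- `ld` on nonempty `TMP`: move one symbol to `k₀` (through `eIn.symm`). [folklore] -/
theorem step_ld_cons (b : Bool) :
    (passTM M eIn eOut).step (cfg M (some (Sum.inr Ctrl.ld)) v S mn (b :: t) c mk) =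
      some (cfg M (some (Sum.inr Ctrl.ld)) v (update S M.k₀ (eIn.symm b :: S M.k₀)) mn t c mk) := by
  rw [cfg, step_inr]; cases b <;> simp [ctrlStmt, rst, bget, cfg]

/-- `ld` on empty `TMP`: jump to the main label of `M`. [folklore] -/
theorem step_ld_nil :
    (passTM M eIn eOut).step (cfg M (some (Sum.inr Ctrl.ld)) v S mn [] c mk) =
      some (cfg M (some (Sum.inl M.main)) v S mn [] c mk) := by
  rw [cfg, step_inr]; simp [ctrlStmt, rst, cfg]

/-- `out1` on nonempty `k₁`: move one symbol to `TMP` (through `eOut`). [folklore] -/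
theorem step_out1_cons (g : M.Γ M.k₁) (L : List (M.Γ M.k₁)) :
    (passTM M eIn eOut).step
        (cfg M (some (Sum.inr Ctrl.out1)) v (update S M.k₁ (g :: L)) mn t c mk) =
      some (cfg M (some (Sum.inr Ctrl.out1)) v (update S M.k₁ L) mn (eOut g :: t) c mk) := by
  rw [cfg, step_inr]; simp [ctrlStmt, rst, bget, cfg]

/-- `out1` on empty `k₁`: proceed to `out2`. [folklore] -/
theorem step_out1_nil :
    (passTM M eIn eOut).step (cfg M (some (Sum.inr Ctrl.out1)) v (update S M.k₁ []) mn t c mk) =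
      some (cfg M (some (Sum.inr Ctrl.out2)) v (update S M.k₁ []) mn t c mk) := by
  rw [cfg, step_inr]; simp [ctrlStmt, rst, cfg]

/-- `out2` on nonempty `TMP`: move one symbol to `MAIN`. [folklore] -/
theorem step_out2_cons (b : Bool) :
    (passTM M eIn eOut).step (cfg M (some (Sum.inr Ctrl.out2)) v S mn (b :: t) c mk) =
      some (cfg M (some (Sum.inr Ctrl.out2)) v S (b :: mn) t c mk) := by
  rw [cfg, step_inr]; cases b <;> simp [ctrlStmt, rst, bget, cfg]

/-- `out2` on empty `TMP`: proceed to `fin`. [folklore] -/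
theorem step_out2_nil :
    (passTM M eIn eOut).step (cfg M (some (Sum.inr Ctrl.out2)) v S mn [] c mk) =
      some (cfg M (some (Sum.inr Ctrl.fin)) v S mn [] c mk) := by
  rw [cfg, step_inr]; simp [ctrlStmt, rst, cfg]

/-- `fin`: reset the state and halt. [folklore] -/
theorem step_fin :
    (passTM M eIn eOut).step (cfg M (some (Sum.inr Ctrl.fin)) v S mn t c mk) =
      some (cfg M none M.initialState S mn t c mk) := by
  rw [cfg, step_inr]; simp [ctrlStmt, cfg]

/-- A step of `M` is a step of the pass-through machine on the embedded configuration.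
[folklore] -/
theorem step_cfgM (a b : M.Cfg) (h : M.step a = some b) (mn : List Bool) :
    (passTM M eIn eOut).step (cfgM a mn) = some (cfgM b mn) := by
  obtain ⟨_ | l, w, S'⟩ := a
  · simp [FinTM2.step, TM2.step] at h
  · simp only [FinTM2.step, TM2.step] at h
    obtain rfl := Option.some.inj h
    simp only [cfgM, Option.elim]
    rw [step_inl, stepAux_trStmt]
    rfl

end Steps

/-! ### Arithmetic of the binary counter -/

section Counter

/-- Leading (low-order) zeros multiply the value by a power of two (`bitsToNat_append` with
`bitsToNat_replicate_false`). [folklore] -/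
theorem bitsToNat_zeros_append (k : ℕ) (l : List Bool) :
    bitsToNat (List.replicate k false ++ l) = 2 ^ k * bitsToNat l := by
  rw [bitsToNat_append, bitsToNat_replicate_false, List.length_replicate, Nat.zero_add]

/-- Leading (low-order) ones: `bitsToNat (1ᵏ ++ l) + 1 = 2ᵏ (bitsToNat l + 1)`. [folklore] -/
theorem bitsToNat_ones_append_succ (k : ℕ) (l : List Bool) :
    bitsToNat (List.replicate k true ++ l) + 1 = 2 ^ k * (bitsToNat l + 1) := by
  induction k with
  | zero => simp
  | succ k ih =>
    rw [List.replicate_succ, List.cons_append, bitsToNat_cons,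
      show 2 ^ (k + 1) * (bitsToNat l + 1) = 2 * (2 ^ k * (bitsToNat l + 1)) by ring, ← ih]
    simp; ring

/-- A bit string of value `0` consists of zeros. [folklore] -/
theorem eq_replicate_of_bitsToNat_eq_zero : ∀ {c : List Bool}, bitsToNat c = 0 →
    c = List.replicate c.length false
  | [], _ => rfl
  | b :: l, h => by
    rw [bitsToNat_cons] at h
    have hb : b = false := by cases b <;> simp_all
    have hl : bitsToNat l = 0 := by omega
    rw [List.length_cons, List.replicate_succ, hb, ← eq_replicate_of_bitsToNat_eq_zero hl]

/-- A bit string of positive value splits at its lowest `1`. [folklore] -/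
theorem exists_split_of_bitsToNat_pos : ∀ {c : List Bool}, 0 < bitsToNat c →
    ∃ k c', c = List.replicate k false ++ true :: c'
  | [], h => by simp at h
  | true :: l, _ => ⟨0, l, rfl⟩
  | false :: l, h => by
    rw [bitsToNat_cons] at h
    obtain ⟨k, c', rfl⟩ := exists_split_of_bitsToNat_pos (c := l) (by simpa using h)
    exact ⟨k + 1, c', rfl⟩

/-- **Binary decrement**: replacing `0ᵏ 1 c'` by `1ᵏ 0 c'` decreases the value by one.
[folklore] -/
theorem bitsToNat_decrement (k : ℕ) (c' : List Bool) :
    bitsToNat (List.replicate k true ++ false :: c') + 1 =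
      bitsToNat (List.replicate k false ++ true :: c') := by
  rw [bitsToNat_ones_append_succ, bitsToNat_zeros_append, bitsToNat_cons, bitsToNat_cons]
  simp; ring

end Counter

/-! ### Phases of the pass-through machine -/

section Phases

variable (v : M.σ) (S : ∀ k, List (M.Γ k))

/-- **Header, digits**: doubled bits at the head of `MAIN` are pushed (reversed) onto `CNT`.
[folklore] -/
theorem hdr_digits (bits : List Bool) (rest t c : List Bool) (mk : List Unit) :
    ReachesIn (C := LCfg M) (passTM M eIn eOut).step
      (cfg M (some (Sum.inr Ctrl.rd1)) v S ((bits.flatMap fun b => [b, b]) ++ rest) t c mk)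
      (cfg M (some (Sum.inr Ctrl.rd1)) v S rest t (bits.reverse ++ c) mk) (2 * bits.length) := by
  induction bits generalizing c with
  | nil => simpa using ReachesIn.refl _ _
  | cons b bits ih =>
    rw [List.flatMap_cons, List.append_assoc, List.length_cons, Nat.mul_succ, Nat.add_comm,
      List.reverse_cons, List.append_assoc, List.singleton_append]
    cases b
    · have h1 := ReachesIn.single (step_rd1_false M eIn eOut v S
        (false :: ((bits.flatMap fun b => [b, b]) ++ rest)) t c mk)
      have h2 := ReachesIn.single (step_rd2f_false M eIn eOut v S
        ((bits.flatMap fun b => [b, b]) ++ rest) t c mk)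
      simpa [Nat.add_comm] using (h1.trans h2).trans (ih (false :: c))
    · have h1 := ReachesIn.single (step_rd1_true M eIn eOut v S
        (true :: ((bits.flatMap fun b => [b, b]) ++ rest)) t c mk)
      have h2 := ReachesIn.single (step_rd2t_true M eIn eOut v S
        ((bits.flatMap fun b => [b, b]) ++ rest) t c mk)
      simpa [Nat.add_comm] using (h1.trans h2).trans (ih (true :: c))

/-- **Header**: reading `passHdr n ++ rest` leaves `encodeNat n` on `CNT` (least significant
bit on top) and `rest` on `MAIN`, at label `dec`, after `|passHdr n|` steps. [folklore] -/
theorem hdr_run (n : ℕ) (rest t : List Bool) (mk : List Unit) :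
    ReachesIn (C := LCfg M) (passTM M eIn eOut).step
      (cfg M (some (Sum.inr Ctrl.rd1)) v S (passHdr n ++ rest) t [] mk)
      (cfg M (some (Sum.inr Ctrl.dec)) v S rest t (encodeNat n) mk) (passHdr n).length := by
  have e : passHdr n ++ rest =
      ((encodeNat n).reverse.flatMap fun b => [b, b]) ++ ([false, true] ++ rest) := by
    simp [passHdr]
  rw [e, length_passHdr]
  have h1 := hdr_digits M eIn eOut v S (encodeNat n).reverse ([false, true] ++ rest) t [] mk
  rw [List.reverse_reverse, List.append_nil, List.length_reverse] at h1
  have h2 := ReachesIn.single (step_rd1_false M eIn eOut v S (true :: rest) t (encodeNat n) mk)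
  have h3 := ReachesIn.single (step_rd2f_true M eIn eOut v S rest t (encodeNat n) mk)
  exact (h1.trans h2).trans h3

/-- `dec` pops `k` low-order zeros, leaving `k` markers. [folklore] -/
theorem dec_zeros (k : ℕ) (mn t c : List Bool) (mk : List Unit) :
    ReachesIn (C := LCfg M) (passTM M eIn eOut).step
      (cfg M (some (Sum.inr Ctrl.dec)) v S mn t (List.replicate k false ++ c) mk)
      (cfg M (some (Sum.inr Ctrl.dec)) v S mn t c (List.replicate k () ++ mk)) k := by
  induction k generalizing mk with
  | zero => simpa using ReachesIn.refl _ _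
  | succ k ih =>
    have e : List.replicate (k + 1) () ++ mk = List.replicate k () ++ (() :: mk) := by
      rw [List.replicate_succ', List.append_assoc, List.singleton_append]
    rw [e, List.replicate_succ, List.cons_append]
    exact ReachesIn.step_trans (step_dec_false M eIn eOut v S mn t _ mk) (ih (() :: mk))

/-- `rf` turns `k` markers into `k` low-order ones and proceeds to `mv`. [folklore] -/
theorem rf_run (k : ℕ) (mn t c : List Bool) :
    ReachesIn (C := LCfg M) (passTM M eIn eOut).step
      (cfg M (some (Sum.inr Ctrl.rf)) v S mn t c (List.replicate k ()))
      (cfg M (some (Sum.inr Ctrl.mv)) v S mn t (List.replicate k true ++ c) []) (k + 1) := by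
  induction k generalizing c with
  | zero => simpa using ReachesIn.single (step_rf_nil M eIn eOut v S mn t c)
  | succ k ih =>
    have e : List.replicate (k + 1) true ++ c = List.replicate k true ++ (true :: c) := by
      rw [List.replicate_succ', List.append_assoc, List.singleton_append]
    rw [e, List.replicate_succ]
    exact ReachesIn.step_trans (step_rf_cons M eIn eOut v S mn t c (List.replicate k ()) ()) (ih (true :: c))

/-- `cln` discards `k` markers and proceeds to `ld`. [folklore] -/
theorem cln_run (k : ℕ) (mn t c : List Bool) :
    ReachesIn (C := LCfg M) (passTM M eIn eOut).step
      (cfg M (some (Sum.inr Ctrl.cln)) v S mn t c (List.replicate k ()))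
      (cfg M (some (Sum.inr Ctrl.ld)) v S mn t c []) (k + 1) := by
  induction k with
  | zero => simpa using ReachesIn.single (step_cln_nil M eIn eOut v S mn t c)
  | succ k ih =>
    rw [List.replicate_succ]
    exact ReachesIn.step_trans (step_cln_cons M eIn eOut v S mn t c _ ()) ih

/-- **One decrement-and-move**: from `dec` with counter `0ᵏ 1 c'` and `b` on top of `MAIN`,
back to `dec` with counter `1ᵏ 0 c'` and `b` moved to `TMP`, in `2k + 3` steps. [folklore] -/
theorem dec_once (k : ℕ) (c' : List Bool) (b : Bool) (mn t : List Bool) :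
    ReachesIn (C := LCfg M) (passTM M eIn eOut).step
      (cfg M (some (Sum.inr Ctrl.dec)) v S (b :: mn) t (List.replicate k false ++ true :: c') [])
      (cfg M (some (Sum.inr Ctrl.dec)) v S mn (b :: t) (List.replicate k true ++ false :: c') [])
      (2 * k + 3) := by
  have h1 := dec_zeros M eIn eOut v S k (b :: mn) t (true :: c') []
  rw [List.append_nil] at h1
  have h2 := ReachesIn.single (step_dec_true M eIn eOut v S (b :: mn) t c' (List.replicate k ()))
  have h3 := rf_run M eIn eOut v S k (b :: mn) t (false :: c')
  have h4 := ReachesIn.single (step_mv_cons M eIn eOut v S mn t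
    (List.replicate k true ++ false :: c') [] b)
  exact (((h1.trans h2).trans h3).trans h4).mono (by omega)

/-- **Exhausted counter**: from `dec` with counter `0ᵏ` to `ld` with `CNT` and `MRK` empty, in
`2k + 2` steps. [folklore] -/
theorem dec_exhaust (k : ℕ) (mn t : List Bool) :
    ReachesIn (C := LCfg M) (passTM M eIn eOut).step
      (cfg M (some (Sum.inr Ctrl.dec)) v S mn t (List.replicate k false) [])
      (cfg M (some (Sum.inr Ctrl.ld)) v S mn t [] []) (2 * k + 2) := by
  have h1 := dec_zeros M eIn eOut v S k mn t [] []
  rw [List.append_nil, List.append_nil] at h1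
  have h2 := ReachesIn.single (step_dec_nil M eIn eOut v S mn t (List.replicate k ()))
  have h3 := cln_run M eIn eOut v S k mn t []
  exact ((h1.trans h2).trans h3).mono (by omega)

/-- **The countdown.** From `dec` with a counter of value `m` and length `≤ B`, markers
empty, and `MAIN = l ++ mn` with `|l| = m`: the machine reaches `ld` with `l` moved (reversed)
onto `TMP`, `MAIN = mn`, counter and markers empty, within `m (2B + 3) + 2B + 2` steps.
[Arora–Barak 2009, §1.3 (counters)] [cite: AroraBarakCC2009, §1.3] -/
theorem countdown (B : ℕ) : ∀ (m : ℕ) (c : List Bool), bitsToNat c = m → c.length ≤ B →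
    ∀ (l mn t : List Bool), l.length = m →
    ReachesIn (C := LCfg M) (passTM M eIn eOut).step
      (cfg M (some (Sum.inr Ctrl.dec)) v S (l ++ mn) t c [])
      (cfg M (some (Sum.inr Ctrl.ld)) v S mn (l.reverse ++ t) [] []) (m * (2 * B + 3) + 2 * B + 2)
  | 0, c, hc, hB, l, mn, t, hl => by
    obtain rfl : l = [] := List.eq_nil_of_length_eq_zero hl
    rw [eq_replicate_of_bitsToNat_eq_zero hc]
    refine (dec_exhaust M eIn eOut v S c.length mn t).mono ?_
    omega
  | m + 1, c, hc, hB, l, mn, t, hl => by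
    obtain ⟨b, l, rfl⟩ : ∃ b l', l = b :: l' := by
      cases l with
      | nil => simp at hl
      | cons b l' => exact ⟨b, l', rfl⟩
    obtain ⟨k, c', rfl⟩ := exists_split_of_bitsToNat_pos (c := c) (by omega)
    have hval : bitsToNat (List.replicate k true ++ false :: c') = m := by
      have := bitsToNat_decrement k c'; omega
    have hlen : (List.replicate k true ++ false :: c').length ≤ B := by simpa using hB
    have hk : 2 * k + 3 ≤ 2 * B + 3 := by simp at hB; omega
    have h1 := dec_once M eIn eOut v S k c' b (l ++ mn) t
    have h2 := countdown B m _ hval hlen l mn (b :: t) (by simpa using hl)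
    rw [List.cons_append, List.reverse_cons, List.append_assoc, List.singleton_append]
    refine (h1.trans h2).mono ?_
    have e3 : (m + 1) * (2 * B + 3) = m * (2 * B + 3) + (2 * B + 3) := by ring
    omega

/-- `ld`: `TMP` is moved (reversed, through `eIn.symm`) on top of the input stack `k₀` of `M`,
then the machine jumps to the main label of `M`. [folklore] -/
theorem ld_run (mn t c : List Bool) (mk : List Unit) :
    ReachesIn (C := LCfg M) (passTM M eIn eOut).step
      (cfg M (some (Sum.inr Ctrl.ld)) v S mn t c mk)
      (cfg M (some (Sum.inl M.main)) v (update S M.k₀ (t.reverse.map eIn.symm ++ S M.k₀)) mn [] c mk)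
      (t.length + 1) := by
  induction t generalizing S with
  | nil => simpa using ReachesIn.single (step_ld_nil M eIn eOut v S mn c mk)
  | cons b t ih =>
    have := ih (update S M.k₀ (eIn.symm b :: S M.k₀))
    rw [update_idem, update_self] at this
    simpa [List.append_assoc] using
      ReachesIn.step_trans (step_ld_cons M eIn eOut v S mn t c mk b) this

/-- `out1`: the output stack `k₁` of `M` is moved (reversed, through `eOut`) onto `TMP`, then
the machine proceeds to `out2`. [folklore] -/
theorem out1_run (L : List (M.Γ M.k₁)) (mn t c : List Bool) (mk : List Unit) :
    ReachesIn (C := LCfg M) (passTM M eIn eOut).step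
      (cfg M (some (Sum.inr Ctrl.out1)) v (update S M.k₁ L) mn t c mk)
      (cfg M (some (Sum.inr Ctrl.out2)) v (update S M.k₁ []) mn (L.reverse.map eOut ++ t) c mk)
      (L.length + 1) := by
  induction L generalizing t with
  | nil => simpa using ReachesIn.single (step_out1_nil M eIn eOut v S mn t c mk)
  | cons g L ih =>
    simpa [List.append_assoc] using
      ReachesIn.step_trans (step_out1_cons M eIn eOut v S mn t c mk g L) (ih (eOut g :: t))

/-- `out2`: `TMP` is moved (reversed) on top of `MAIN`, then the machine proceeds to `fin`.
[folklore] -/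
theorem out2_run (mn t c : List Bool) (mk : List Unit) :
    ReachesIn (C := LCfg M) (passTM M eIn eOut).step
      (cfg M (some (Sum.inr Ctrl.out2)) v S mn t c mk)
      (cfg M (some (Sum.inr Ctrl.fin)) v S (t.reverse ++ mn) [] c mk) (t.length + 1) := by
  induction t generalizing mn with
  | nil => simpa using ReachesIn.single (step_out2_nil M eIn eOut v S mn c mk)
  | cons b t ih =>
    simpa [List.append_assoc] using
      ReachesIn.step_trans (step_out2_cons M eIn eOut v S mn t c mk b) (ih (b :: mn))

/-- A run of `M` is a run of the pass-through machine on embedded configurations. [folklore] -/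
theorem run_cfgM {n : ℕ} {a b : M.Cfg} (h : (flip bind M.step)^[n] (some a) = some b)
    (mn : List Bool) :
    (flip bind (passTM M eIn eOut).step)^[n] (some (cfgM a mn)) = some (cfgM b mn) :=
  iterate_bind_map M.step (passTM M eIn eOut).step (fun x => cfgM x mn)
    (fun x y hxy => step_cfgM M eIn eOut x y hxy mn) n a b h

/-- The initial configuration of the pass-through machine. [folklore] -/
theorem initList_passTM (l : List Bool) :
    initList (passTM M eIn eOut) l =
      cfg M (some (Sum.inr Ctrl.rd1)) M.initialState (fun _ => []) l [] [] [] := by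
  rw [initList_eq]
  change (⟨some (Sum.inr Ctrl.rd1), (M.initialState, none),
      update (fun j => ([] : List (PassΓ M.Γ j))) (Sum.inr Aux.MAIN) l⟩ :
      TM2.Cfg (PassΓ M.Γ) (M.Λ ⊕ Ctrl) (St M.σ)) = _
  rw [← mkStk_bot_MAIN]
  rfl

/-- The halting configuration of the pass-through machine. [folklore] -/
theorem haltList_passTM (l : List Bool) :
    haltList (passTM M eIn eOut) l = cfg M none M.initialState (fun _ => []) l [] [] [] := by
  rw [haltList_eq]
  change (⟨none, (M.initialState, none),
      update (fun j => ([] : List (PassΓ M.Γ j))) (Sum.inr Aux.MAIN) l⟩ :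
      TM2.Cfg (PassΓ M.Γ) (M.Λ ⊕ Ctrl) (St M.σ)) = _
  rw [← mkStk_bot_MAIN]
  rfl

/-- The embedded initial configuration of `M` on input `l`, above the suffix `mn`. [folklore] -/
theorem cfgM_initList (l : List (M.Γ M.k₀)) (mn : List Bool) :
    cfgM (initList M l) mn =
      cfg M (some (Sum.inl M.main)) M.initialState (update (fun _ => []) M.k₀ l) mn [] [] [] := by
  rw [initList_eq]; rfl

/-- The embedded halting configuration of `M` with output `L`, above the suffix `mn`: the
pass-through machine is at `out1`. [folklore] -/
theorem cfgM_haltList (L : List (M.Γ M.k₁)) (mn : List Bool) :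
    cfgM (haltList M L) mn =
      cfg M (some (Sum.inr Ctrl.out1)) M.initialState (update (fun _ => []) M.k₁ L) mn [] [] [] := by
  rw [haltList_eq]; rfl

end Phases

end Bundled

/-! ### The pass-through machine computes `F(s) ++ σ` in time independent of `σ` -/

section Main

variable (Mx : TM2ComputableAux Bool Bool) (p : Polynomial ℕ) {F : List Bool → List Bool}
  (hF : ∀ a, Mx.OutputsWithin a (F a) (p.eval a.length))

/-- The pass-through machine of `Mx : TM2ComputableAux Bool Bool`, as a machine with input
and output alphabet `Bool` (one stack serving as both). [folklore] -/
noncomputable def passAux : TM2ComputableAux Bool Bool :=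
  ⟨passTM Mx.tm Mx.inputAlphabet Mx.outputAlphabet, Equiv.refl _, Equiv.refl _⟩

/-- The running-time polynomial of the pass-through machine in terms of the time polynomial
`p` of `M` and its push bound `D`: `2N² + 12N + 12 + (2D + 1) p`. [folklore] -/
noncomputable def passPoly (p : Polynomial ℕ) (D : ℕ) : Polynomial ℕ :=
  2 * Polynomial.X ^ 2 + 12 * Polynomial.X + 12 + Polynomial.C (2 * D + 1) * p

/-- Evaluation of `passPoly`. [folklore] -/
theorem passPoly_eval (p : Polynomial ℕ) (D N : ℕ) :
    (passPoly p D).eval N = 2 * N ^ 2 + 12 * N + 12 + (2 * D + 1) * p.eval N := by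
  simp [passPoly]

include hF in
/-- **Correctness and running time of the pass-through machine.** If `Mx` computes `F` in
time `p`, then on input `passHdr |s| ++ s ++ σ` the pass-through machine halts with output
`F s ++ σ` within `passPoly p D (|s|)` steps, `D` the push bound of `Mx` — for *every* suffix
`σ`, which is never read. [Arora–Barak 2009, §1.3; Liu–Pass 2020, proofs of Thms 5.5–5.6]
[cite: AroraBarakCC2009, §1.3] -/
theorem passAux_outputsWithin (s σ : List Bool) :
    (passAux Mx).OutputsWithin (passHdr s.length ++ s ++ σ) (F s ++ σ)
      ((passPoly p (machinePushBound Mx.tm)).eval s.length) := by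
  apply outputsWithin_of_reachesIn
  have hin : (passHdr s.length ++ s ++ σ).map (passAux Mx).inputAlphabet.symm =
      passHdr s.length ++ (s ++ σ) := by rw [List.append_assoc]; exact List.map_id _
  have hout : (F s ++ σ).map (passAux Mx).outputAlphabet.symm = F s ++ σ := List.map_id _
  rw [hin, hout]
  change ReachesIn (C := LCfg Mx.tm) (passTM Mx.tm Mx.inputAlphabet Mx.outputAlphabet).step
    (initList (passTM Mx.tm Mx.inputAlphabet Mx.outputAlphabet) _)
    (haltList (passTM Mx.tm Mx.inputAlphabet Mx.outputAlphabet) _) _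
  rw [initList_passTM, haltList_passTM]
  set n := s.length with hn
  -- header
  have h1 := hdr_run Mx.tm Mx.inputAlphabet Mx.outputAlphabet Mx.tm.initialState (fun _ => [])
    n (s ++ σ) [] []
  -- countdown
  have h2 := countdown Mx.tm Mx.inputAlphabet Mx.outputAlphabet Mx.tm.initialState (fun _ => [])
    (n + 1) n (encodeNat n) (bitsToNat_encodeNat n) (length_encodeNat_le_self n) s σ [] hn.symm
  rw [List.append_nil] at h2
  -- load `s` onto the input stack of `M`
  have h3 := ld_run Mx.tm Mx.inputAlphabet Mx.outputAlphabet Mx.tm.initialState (fun _ => [])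
    σ (s.reverse ++ []) [] []
  rw [List.append_nil, List.reverse_reverse, List.length_reverse, List.append_nil,
    ← cfgM_initList] at h3
  -- run `M`
  have h4 : ReachesIn (C := LCfg Mx.tm) (passTM Mx.tm Mx.inputAlphabet Mx.outputAlphabet).step
      (cfgM (initList Mx.tm (s.map Mx.inputAlphabet.symm)) σ)
      (cfgM (haltList Mx.tm ((F s).map Mx.outputAlphabet.symm)) σ) (p.eval n) := by
    obtain ⟨k, hk, e⟩ := reachesIn_of_outputsWithin Mx (hF s)
    exact ⟨k, hk, run_cfgM Mx.tm Mx.inputAlphabet Mx.outputAlphabet e σ⟩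
  rw [cfgM_haltList] at h4
  -- unload the output of `M`
  have h5 := out1_run Mx.tm Mx.inputAlphabet Mx.outputAlphabet Mx.tm.initialState (fun _ => [])
    ((F s).map Mx.outputAlphabet.symm) σ [] [] []
  have e5 : ((F s).map Mx.outputAlphabet.symm).reverse.map Mx.outputAlphabet ++ [] =
      (F s).reverse := by simp [List.map_reverse]
  have e6 : update (fun k : Mx.tm.K => ([] : List (Mx.tm.Γ k))) Mx.tm.k₁ [] = fun k => [] :=
    update_eq_self Mx.tm.k₁ (fun k : Mx.tm.K => ([] : List (Mx.tm.Γ k)))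
  rw [e5, List.length_map, e6] at h5
  have h6 := out2_run Mx.tm Mx.inputAlphabet Mx.outputAlphabet Mx.tm.initialState (fun _ => [])
    σ (F s).reverse [] []
  rw [List.reverse_reverse, List.length_reverse] at h6
  have h7 := ReachesIn.single (step_fin Mx.tm Mx.inputAlphabet Mx.outputAlphabet
    Mx.tm.initialState (fun _ => []) (F s ++ σ) [] [] [])
  have := (((((h1.trans h2).trans h3).trans h4).trans h5).trans h6).trans h7
  refine this.mono ?_
  -- the polynomial bound
  have hFs : (F s).length ≤ n + machinePushBound Mx.tm * p.eval n := (hF s).length_le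
  have hH : (passHdr n).length ≤ 2 * n + 4 := by
    rw [length_passHdr]; have := length_encodeNat_le_self n; omega
  rw [passPoly_eval]
  set D := machinePushBound Mx.tm
  have e1 : n * (2 * (n + 1) + 3) = 2 * n ^ 2 + 5 * n := by ring
  have e2 : (2 * D + 1) * p.eval n = 2 * (D * p.eval n) + p.eval n := by ring
  omega

/-- **Pass-through computation of a polynomial-time map.** For every polynomial-time
`F : {0,1}* → {0,1}*` there are a TM2 machine `M` over `Bool` and a polynomial `T` such that
on input `passHdr |s| ++ s ++ σ` — the self-delimiting binary header announcing `|s|`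
(`|passHdr n| ≤ 2⌊log₂ n⌋ + 4`), then `s`, then any suffix `σ` — `M` outputs `F s ++ σ` within
`T(|s|)` steps, a bound independent of `σ`. [Arora–Barak 2009, §1.3; Liu–Pass 2020, proofs of
Thms 5.5–5.6 (generators padded with untouched extra bits)] [cite: AroraBarakCC2009, §1.3] -/
theorem exists_passThrough {F : List Bool → List Bool} (hF : PolyTimeComputable id id F) :
    ∃ (M : TM2ComputableAux Bool Bool) (T : Polynomial ℕ), ∀ s σ : List Bool,
      M.OutputsWithin (passHdr s.length ++ s ++ σ) (F s ++ σ) (T.eval s.length) := by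
  obtain ⟨p, Mx, h⟩ := hF
  exact ⟨passAux Mx, passPoly p (machinePushBound Mx.tm), fun s σ =>
    passAux_outputsWithin Mx p (fun a => h a) s σ⟩

end Main

end TM2Pass

end Literature.Computability.Complexity
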